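import Literature.MathematicalPhysics.QuantumFieldTheory.Balaban1983to89.Node00.BgSchemePrOfRecord
import Literature.MathematicalPhysics.QuantumFieldTheory.Balaban1983to89.Node00.BgSchemeOfRecordC
import HarnessLib

/-!
# NODE 00 — `BgSchemePrOfRecordC`: THE COMPLEX EDITION OF THE FRAMED, (47)-CARRYING SCHEME OF RECORD — `𝔄^{pr} = H₁^{pr}B`, the fixed point
# `𝒜^{pr}`, the transformed small field `T^{pr}(𝒜^{pr} + 𝔄^{pr})` ((47) at the framed Sect. C pair) and the background field
# `exp(iη·T^{pr}(𝒜^{pr} + 𝔄^{pr}))U₀` AS FUNCTIONS OF A COMPLEX (`Gᶜ`-valued) DATUM, their `rfl` reality bridges to ✓`bgSchemePrOfRecord … 𝔥 …`,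
# and their ℂ-analyticity modulo the DISPLAYED regime ∕ analyticity letters ([B11] Prop. 9 p.309, Prop. 3 p.289, Sect. G p.307)

Cell `pub-ymgap` (YM-PLAN Track A), seat `pub-ymgap-node00-def-Y` (g41; custodian of the `BgScheme` instance of record; Node00 definition lane;
count-neutral, `--supports stmt-QuantumFields-27238`).  ★★★ director-ym №629∕№630∕№631 (4)∕№632 (2): «(C) continuation» of the Node00
edition of record past the G-door — file (C2), the framed twin of ✓`Node00.BgSchemeOfRecordC` §2–§4 (def-Y g37) at the FRAMED slots of
✓`Node00.BgLettersPrOfRecord` ((A3): `H₁^{pr}`, `𝔊^{pr}`, `W^{pr}`, `C^{sl,pr}` at the pair `(Q^{pr}(U₀) 𝔥, Q′(U₀))` of a frame datum `𝔥`) and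
of the (47)-carrying framed scheme ✓`bgSchemePrOfRecord` ((A4)), with (47) `T^{pr} = T47 H₁^{pr} C^{sl,pr} ε_C` (lit ✓`B11Eq90V0GroupComposed.T47`)
INSIDE the exponent — №632 (2) (Q-B): «BOTH LAYERS, PRIMITIVE FIRST» (the analyticity of (47) is a DISPLAYED primitive letter `LinPrAnalyticTok`,
supplied from the framed Sect. C regime by ONE corollary `…_of_regimeC` over lit ✓`analyticOnNhd_T47`).  [B11] = [Balaban1985Variational].

PRINT.  [B11] Sect. G p.307: «all the operators and functions above … are analytic functions of these configurations»; Prop. 9 p.309: the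
solution of (116) «is an analytic function … also of the external gauge field configuration» and the minimising configuration «has an extension
to an analytic function of `Gᶜ`-valued configurations»; Prop. 3 p.289: «the transformation (47) … is defined and analytic».  The framed scheme's
data `𝔊^{pr}`, `W^{pr}`, `J` are INDEPENDENT of the datum `V` (data at `U₀`); the one `V`-dependent letter is (20)'s chart-free `B(V)`, so — exactly
as in the unframed file — the complex edition lets `B` act on complex level-`k` bond matrices `Z` (✓`BOfRecordC`, cited verbatim: frame-free)
and composes with the landed linear `H₁^{pr}`, the parameter-analytic fixed point (lit ✓`B11Claim309UAnalytic.analyticOnNhd_solA`), the analytic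
map (47) on the ball `‖A′‖ < a_C` (lit ✓`analyticOnNhd_T47`) and the entire chart ✓`expOver U₀`.

CONTENTS (displayed REAL background `U₀`, ONE frame datum `𝔥 : FrameDatum (F.P K) N k U₀` as a BINDER — no datum instantiated; the complex
variable is the level-`k` DATUM `Z : PBond (F.P K) k → Matrix (Fin N) (Fin N) ℂ`).
* §1 `frakAprOfRecordAtBg128C` — (103)'s `𝔄^{pr} = H₁^{pr}B` on complex data; `… (coeField V) = frakAprOfRecordAtBg128 … V` (`rfl`); zero at the
  averaged background; analytic on the log-polydisc (CLM ∘ ✓`analyticAt_BOfRecordC`).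
* §2 `solPrOfRecordC` — (116)'s selected fixed point `𝒜^{pr}` on complex data; `… (coeField V) = (bgSchemePrOfRecord …).sol V` (`rfl`);
  ★ `analyticOnNhd_solPrOfRecordC` — ONE CALL of ✓`analyticOnNhd_solA` (data constant in the parameter), hypotheses = the uniform regime
  `Regime 𝔊^{pr} 0 W^{pr} B₀ 0 C₄ a₃ j a𝔄 ε₄`, `‖J‖ ≤ j`, `‖𝔄^{pr,ᶜ}(Z)‖ < a𝔄` on `𝒪`, the log-polydisc on `𝒪`, Prop. 4's analyticity of `W^{pr}`
  (token `WAnalyticPrTok`); `…_of_regimeTok` reads the first two off the scheme's `RegimeTok`; the bounds `‖𝒜^{pr,ᶜ}(Z)‖ ≤ ε₄` and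
  `‖𝒜^{pr,ᶜ}(Z) + 𝔄^{pr,ᶜ}(Z)‖ < a_C` once `ε₄ + a𝔄 ≤ a_C` (lit ✓`Regime.solA_mem`).
* §3 `linPrSmallFieldC` — THE TRANSFORMED FULL SMALL FIELD `T^{pr}(𝒜^{pr,ᶜ}(Z) + 𝔄^{pr,ᶜ}(Z))` ((47) applied; `… (coeField V) =
  linPrOfRecord … V (𝔖.sol V + 𝔖.𝔄 V)`, `rfl`); the primitive letter `LinPrAnalyticTok … ε_C a_C` («(47) is analytic on `‖A′‖ < a_C`», Prop. 3)
  with its supplier `linPrAnalyticTok_of_regimeC (RC) (hC)` (lit ✓`analyticOnNhd_T47`); ★ `analyticOnNhd_linPrSmallFieldC` (primitive) and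
  `…_of_regimeC` (framed Sect. C regime `RC`, `Prop4Hyp C^{sl,pr} C₂ c₄`, `ε₄ + a𝔄 ≤ a_C` displayed).
* §4 `bgFieldPrOfRecordC` — THE COMPLEX BACKGROUND FIELD OF THE (47)-CARRYING FRAMED SCHEME «`U = exp(iηA)U₀`, `A = T^{pr}(𝒜^{pr} + 𝔄^{pr})`» on
  complex data; reality `= expOver U₀ (𝔖.ev (linPrOfRecord … V (𝔖.sol V + 𝔖.𝔄 V)))` (`rfl`), hence `= ↑(𝔖.chartCfgLin T^{pr} V b)` on the `SU(N)`
  bonds ((A4) ✓`BgScheme.coe_chartLin_of_mem`); ★ analytic on `𝒪` (entire chart ∘ CLM ∘ §3), primitive and `…_of_regimeC` forms.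

HONEST LABELS.  Definitions, `rfl` bridges, and analyticity theorems that are COMPOSITIONS of landed ones; the regime (117)–(121), the bound on
`J` (28), the smallness of `𝔄^{pr,ᶜ}` on `𝒪` (46)∕(103), the log-polydisc, Prop. 4's analyticity of `W^{pr}`, Prop. 3's analyticity of (47) (or the
framed Sect. C regime + (ℓa-C) that imply it), the radius inequality `ε₄ + a𝔄 ≤ a_C`, `hposπ`∕`hposb` ([B8] Thm 3.11∕3.12 at the framed pair) and
`hQ` (`Q^{pr}(U₀) 𝔥` onto; supplier of record GL-only, ✓`QprOfRecord_one_surjective_rec`) are HYPOTHESES (displayed, never asserted); the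
`k`-UNIFORMITY of constants is the consumer's quantifier order.  NOT here: the fine-field ∕ averaged sockets (unframed §5∕§6 serve the
UNFRAMED P0C road), covariance, (1.21) decay, any `∃` over scheme data; no edit of any landed file.  No `sorry`, no new axiom, no instance ∕
notation.  Nothing here is a claim about the Yang–Mills mass gap (`Summit.QuantumFields`): finite torus, fixed `ε`; nothing continuum ∕ OS ∕ Clay.
-/

noncomputable section

open scoped Matrix Matrix.Norms.L2Operator InnerProductSpace ComplexConjugate Topology

namespace Literature.MathematicalPhysics.QuantumFieldTheory.Balaban1983to89.Node00

open T4Continuum BlockAveraging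
open NormedSpace (exp)
open B11Eq103H1Complex (BondL2K SiteL2K)
open B11Eq115Space (Space115 NegSize NegSup JetSup levWeight)
open B11Eq174Chart (Regime solA)
open B11Prop6Scheme (Prop4Hyp)
open B11Eq90V0GroupComposed (T47 analyticOnNhd_T47)
open B11Claim309UAnalytic (analyticOnNhd_solA)

section Record

variable (F : T4Family) (N : ℕ) [NeZero N] (K : ℕ) (k : ℕ) (Ω : ℕ → Set (Site (F.P K) 0)) (U₀ : GaugeField (F.P K) 0 (SU N))
variable [Fact (0 < (F.L : ℝ))] [Fact (0 < (F.P K).eta k)] [Fact (0 < c0Rec F K k)] [Fact (∀ c, 0 < wBRec F K k c)]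
variable (𝔥 : FrameDatum (F.P K) N k U₀) (levB : PBond (F.P K) k → ℕ)
  (Gp : SiteL2K ℂ (F.P K).d (fun _ => (F.P K).sitesPerDir 0) (c0Rec F K k) (WRec N) →ₗ[ℂ]
    SiteL2K ℂ (F.P K).d (fun _ => (F.P K).sitesPerDir 0) (c0Rec F K k) (WRec N))
  (Δ2 : BondL2K ℂ (F.P K).d (fun _ => (F.P K).sitesPerDir 0) (c0Rec F K k) (WRec N) →ₗ[ℂ]
    BondL2K ℂ (F.P K).d (fun _ => (F.P K).sitesPerDir 0) (c0Rec F K k) (WRec N)) (a : ℝ)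
  (hposπ : ∀ x, x ≠ 0 → 0 < RCLike.re ⟪x, laplaceAOfRecordAt F N k U₀ (hessOpOfRecord128 F N k U₀ Gp (QprimeOfRecord F N k U₀) Δ2)
    (QprOfRecord F N k U₀ 𝔥) (QprimeOfRecord F N k U₀) a x⟫_ℂ)
  (hposb : ∀ x, x ≠ 0 → 0 < RCLike.re ⟪x, laplaceAOfRecord F N k U₀ (QprOfRecord F N k U₀ 𝔥) (QprimeOfRecord F N k U₀) a x⟫_ℂ)
  (hQ : Function.Surjective (QprOfRecord F N k U₀ 𝔥))

/-! ## §1. (103)'s `𝔄^{pr} = H₁^{pr}B` on complex data (framed slot (c)) -/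

/-- ★ **(103)'s `𝔄^{pr} = H₁^{pr}B` ON COMPLEX DATA, FRAMED SLOT (c)**: `𝔄^{pr,ᶜ}(Z) = H₁^{pr}(U₀)(Bᶜ(Z))` with (A3)'s `H1prOfRecordAtBg128 … 𝔥` (the
framed scheme of record's `𝔄`-slot, un-restricted to `SU(N)`-valued data); `B` is chart- and frame-free (✓`BOfRecordC`, cited verbatim).
[cite: Balaban1985Variational, (103) p.293, (20) p.281, Prop. 9 p.309] -/
def frakAprOfRecordAtBg128C (Z : PBond (F.P K) k → Matrix (Fin N) (Fin N) ℂ) : Space115Lit F N K k Ω U₀ :=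
  H1prOfRecordAtBg128 F N K k Ω U₀ 𝔥 levB Gp Δ2 a hposπ hQ (BOfRecordC F N K k U₀ levB Z)

/-- ★ **REALITY**: on an `SU(N)`-valued datum `𝔄^{pr,ᶜ}` IS (A3)'s `frakAprOfRecordAtBg128` = the framed scheme's `𝔄 V` (`rfl`).
[cite: Balaban1985Variational, (103) p.293, Prop. 9 p.309] -/
theorem frakAprOfRecordAtBg128C_coeField (V : GaugeField (F.P K) k (SU N)) :
    frakAprOfRecordAtBg128C F N K k Ω U₀ 𝔥 levB Gp Δ2 a hposπ hQ (coeField V) = frakAprOfRecordAtBg128 F N K k Ω U₀ 𝔥 levB Gp Δ2 a hposπ hQ V := rfl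

/-- `𝔄^{pr,ᶜ}` vanishes at the averaged background ((A4) ✓`frakAprOfRecordAtBg128_self`). [cite: Balaban1985Variational, (20) p.281, (103) p.293] -/
theorem frakAprOfRecordAtBg128C_self :
    frakAprOfRecordAtBg128C F N K k Ω U₀ 𝔥 levB Gp Δ2 a hposπ hQ (coeField (Averaging.iter (avOfRecord F N K) k U₀)) = 0 := by
  rw [frakAprOfRecordAtBg128C_coeField]
  exact frakAprOfRecordAtBg128_self F N K k Ω U₀ 𝔥 levB Gp Δ2 a hposπ hQ

/-- ★ **`𝔄^{pr,ᶜ}` IS ℂ-ANALYTIC ON THE LOG-POLYDISC** (a continuous linear `H₁^{pr}` after ✓`analyticAt_BOfRecordC`).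
[cite: Balaban1985Variational, Sect. G p.307, (103) p.293, Prop. 9 p.309] -/
theorem analyticAt_frakAprOfRecordAtBg128C {Z : PBond (F.P K) k → Matrix (Fin N) (Fin N) ℂ}
    (hlog : ∀ c : PBond (F.P K) k, ‖Z c * star (Averaging.iter (avOfRecord F N K) k U₀ c : Matrix (Fin N) (Fin N) ℂ) - 1‖ < 1) :
    AnalyticAt ℂ (frakAprOfRecordAtBg128C F N K k Ω U₀ 𝔥 levB Gp Δ2 a hposπ hQ) Z :=
  ((H1prOfRecordAtBg128 F N K k Ω U₀ 𝔥 levB Gp Δ2 a hposπ hQ).analyticAt _).comp (analyticAt_BOfRecordC F N k U₀ levB hlog)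

/-! ## §2. (116)'s fixed point `𝒜^{pr}` as a function of the complex datum -/

/-- ★★ **THE FIXED POINT OF (116) ON COMPLEX DATA, FRAMED**: `𝒜^{pr,ᶜ}(Z) = solA 𝔊^{pr}(U₀) 0 W^{pr}(U₀) J(U₀) ε₄ 𝔄^{pr,ᶜ}(Z)` — the framed scheme of
record's selected solution of `X = −𝔊J − 𝔊W(X + 𝔄)` with the shift evaluated on the complex datum (the data `𝔊^{pr}`, `W^{pr}`, `J` live at `U₀`).
[cite: Balaban1985Variational, Prop. 6 (116) p.295, Prop. 9 p.309] -/
def solPrOfRecordC (εC ε₄ : ℝ) (Z : PBond (F.P K) k → Matrix (Fin N) (Fin N) ℂ) : Space115Lit F N K k Ω U₀ :=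
  solA (frakGprOfRecordAtBg128 F N K k Ω U₀ 𝔥 Gp Δ2 a hposπ hQ) 0 (WprOfRecordAt F N K k Ω U₀ 𝔥 levB a hposb hQ εC Gp)
    (JOfRecordAtBg F N K k Ω U₀) ε₄ (frakAprOfRecordAtBg128C F N K k Ω U₀ 𝔥 levB Gp Δ2 a hposπ hQ Z)

/-- ★ **REALITY**: on an `SU(N)`-valued datum `𝒜^{pr,ᶜ}` IS the framed scheme of record's `sol` (`rfl`; any `dom` and displayed constants).
[cite: Balaban1985Variational, Prop. 6 (116) p.295, Prop. 9 p.309] -/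
theorem solPrOfRecordC_coeField (dom : Set (GaugeField (F.P K) k (SU N))) (εC B₀ C₄ a₃ j a𝔄 ε₄ : ℝ) (V : GaugeField (F.P K) k (SU N)) :
    solPrOfRecordC F N K k Ω U₀ 𝔥 levB Gp Δ2 a hposπ hposb hQ εC ε₄ (coeField V) =
      (bgSchemePrOfRecord F N K k Ω U₀ 𝔥 dom levB Gp Δ2 a hposπ hposb hQ εC B₀ C₄ a₃ j a𝔄 ε₄).sol V := rfl

/-- **TOKEN (Prop. 4's analyticity of `W^{pr}`)** — «(δ/δA′)V … is analytic» on the ball `{‖Y‖ < a₃}` for the framed `W^{pr}` (the joint-analyticity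
premise of `analyticOnNhd_solA` for parameter-independent `W`; `Regime.quad` records only LINE analyticity).  A named hypothesis, never asserted.
[cite: Balaban1985Variational, Prop. 4 p.292, (80) p.290, p.309] -/
def WAnalyticPrTok (εC a₃ : ℝ) : Prop :=
  AnalyticOnNhd ℂ (WprOfRecordAt F N K k Ω U₀ 𝔥 levB a hposb hQ εC Gp) {Y : Space115Lit F N K k Ω U₀ | ‖Y‖ < a₃}

/-- ★★★ **«THE SOLUTION IS AN ANALYTIC FUNCTION OF THE `Gᶜ`-VALUED DATUM», FRAMED** (Prop. 9 at the framed record, datum variable): on an OPEN set `𝒪`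
of complex level-`k` data inside the log-polydisc on which `‖𝔄^{pr,ᶜ}‖ < a𝔄`, under the regime of Prop. 6 for the framed data at `U₀`
(`Regime 𝔊^{pr} 0 W^{pr} B₀ 0 C₄ a₃ j a𝔄 ε₄`, `‖J‖ ≤ j`) and Prop. 4's analyticity of `W^{pr}`, the fixed point `Z ↦ 𝒜^{pr,ᶜ}(Z)` is ℂ-analytic on `𝒪` —
ONE call of lit ✓`analyticOnNhd_solA` with `𝔊`, `Λ = 0`, `W`, `J` constant in the parameter (verbatim the unframed proof).
[cite: Balaban1985Variational, Prop. 9 p.309, Prop. 6 (116)–(121) p.295] -/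
theorem analyticOnNhd_solPrOfRecordC {εC B₀ C₄ a₃ j a𝔄 ε₄ : ℝ} {𝒪 : Set (PBond (F.P K) k → Matrix (Fin N) (Fin N) ℂ)} (h𝒪 : IsOpen 𝒪)
    (R : Regime (frakGprOfRecordAtBg128 F N K k Ω U₀ 𝔥 Gp Δ2 a hposπ hQ) (0 : Space115Lit F N K k Ω U₀ →L[ℂ] Space115Lit F N K k Ω U₀)
      (WprOfRecordAt F N K k Ω U₀ 𝔥 levB a hposb hQ εC Gp) B₀ 0 C₄ a₃ j a𝔄 ε₄)
    (hJ : ‖JOfRecordAtBg F N K k Ω U₀‖ ≤ j) (h𝔄 : ∀ Z ∈ 𝒪, ‖frakAprOfRecordAtBg128C F N K k Ω U₀ 𝔥 levB Gp Δ2 a hposπ hQ Z‖ < a𝔄)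
    (hlog : ∀ Z ∈ 𝒪, ∀ c : PBond (F.P K) k, ‖Z c * star (Averaging.iter (avOfRecord F N K) k U₀ c : Matrix (Fin N) (Fin N) ℂ) - 1‖ < 1)
    (hW : WAnalyticPrTok F N K k Ω U₀ 𝔥 levB Gp a hposb hQ εC a₃) :
    AnalyticOnNhd ℂ (solPrOfRecordC F N K k Ω U₀ 𝔥 levB Gp Δ2 a hposπ hposb hQ εC ε₄) 𝒪 := by
  have hWp : AnalyticOnNhd ℂ (fun p : (PBond (F.P K) k → Matrix (Fin N) (Fin N) ℂ) × Space115Lit F N K k Ω U₀ =>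
      WprOfRecordAt F N K k Ω U₀ 𝔥 levB a hposb hQ εC Gp p.2) (𝒪 ×ˢ {Y : Space115Lit F N K k Ω U₀ | ‖Y‖ < a₃}) :=
    fun p hp => (hW p.2 (Set.mem_prod.1 hp).2).comp_of_eq analyticAt_snd rfl
  exact analyticOnNhd_solA (𝒢 := fun _ => frakGprOfRecordAtBg128 F N K k Ω U₀ 𝔥 Gp Δ2 a hposπ hQ)
    (Λ := fun _ => (0 : Space115Lit F N K k Ω U₀ →L[ℂ] Space115Lit F N K k Ω U₀))
    (W := fun _ => WprOfRecordAt F N K k Ω U₀ 𝔥 levB a hposb hQ εC Gp) (J := fun _ => JOfRecordAtBg F N K k Ω U₀)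
    (𝔄 := frakAprOfRecordAtBg128C F N K k Ω U₀ 𝔥 levB Gp Δ2 a hposπ hQ) h𝒪 (fun _ _ => R) (fun _ _ => hJ) h𝔄
    (fun _ _ => analyticAt_const) (fun _ _ => analyticAt_const) hWp (fun _ _ => analyticAt_const)
    (fun Z hZ => analyticAt_frakAprOfRecordAtBg128C F N K k Ω U₀ 𝔥 levB Gp Δ2 a hposπ hQ (hlog Z hZ))

/-- The same with the regime and the bound on `J` read off the framed scheme of record's `RegimeTok` at ANY datum of a nonempty domain (the data do
not see the datum). [cite: Balaban1985Variational, Prop. 6 (117)–(121) p.295, Prop. 9 p.309] -/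
theorem analyticOnNhd_solPrOfRecordC_of_regimeTok {dom : Set (GaugeField (F.P K) k (SU N))} {εC B₀ C₄ a₃ j a𝔄 ε₄ : ℝ}
    (hT : (bgSchemePrOfRecord F N K k Ω U₀ 𝔥 dom levB Gp Δ2 a hposπ hposb hQ εC B₀ C₄ a₃ j a𝔄 ε₄).RegimeTok) {V₀ : GaugeField (F.P K) k (SU N)}
    (hV₀ : V₀ ∈ dom) {𝒪 : Set (PBond (F.P K) k → Matrix (Fin N) (Fin N) ℂ)} (h𝒪 : IsOpen 𝒪)
    (h𝔄 : ∀ Z ∈ 𝒪, ‖frakAprOfRecordAtBg128C F N K k Ω U₀ 𝔥 levB Gp Δ2 a hposπ hQ Z‖ < a𝔄)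
    (hlog : ∀ Z ∈ 𝒪, ∀ c : PBond (F.P K) k, ‖Z c * star (Averaging.iter (avOfRecord F N K) k U₀ c : Matrix (Fin N) (Fin N) ℂ) - 1‖ < 1)
    (hW : WAnalyticPrTok F N K k Ω U₀ 𝔥 levB Gp a hposb hQ εC a₃) :
    AnalyticOnNhd ℂ (solPrOfRecordC F N K k Ω U₀ 𝔥 levB Gp Δ2 a hposπ hposb hQ εC ε₄) 𝒪 :=
  analyticOnNhd_solPrOfRecordC F N K k Ω U₀ 𝔥 levB Gp Δ2 a hposπ hposb hQ h𝒪 (hT V₀ hV₀).1 (hT V₀ hV₀).2.1 h𝔄 hlog hW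

/-- **`‖𝒜^{pr,ᶜ}(Z)‖ ≤ ε₄`** under the regime, `‖J‖ ≤ j` and `‖𝔄^{pr,ᶜ}(Z)‖ < a𝔄` (lit ✓`Regime.solA_mem`: the selected solution lies in the ball
(116) is solved in). [cite: Balaban1985Variational, Prop. 6 (116)–(117) p.295] -/
theorem norm_solPrOfRecordC_le {εC B₀ C₄ a₃ j a𝔄 ε₄ : ℝ}
    (R : Regime (frakGprOfRecordAtBg128 F N K k Ω U₀ 𝔥 Gp Δ2 a hposπ hQ) (0 : Space115Lit F N K k Ω U₀ →L[ℂ] Space115Lit F N K k Ω U₀)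
      (WprOfRecordAt F N K k Ω U₀ 𝔥 levB a hposb hQ εC Gp) B₀ 0 C₄ a₃ j a𝔄 ε₄)
    (hJ : ‖JOfRecordAtBg F N K k Ω U₀‖ ≤ j) {Z : PBond (F.P K) k → Matrix (Fin N) (Fin N) ℂ}
    (h𝔄Z : ‖frakAprOfRecordAtBg128C F N K k Ω U₀ 𝔥 levB Gp Δ2 a hposπ hQ Z‖ < a𝔄) :
    ‖solPrOfRecordC F N K k Ω U₀ 𝔥 levB Gp Δ2 a hposπ hposb hQ εC ε₄ Z‖ ≤ ε₄ :=
  (R.solA_mem hJ h𝔄Z).1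

/-- **`‖𝒜^{pr,ᶜ}(Z) + 𝔄^{pr,ᶜ}(Z)‖ < a_C`** once the Sect. C radius covers the scheme's ball plus the shift, `ε₄ + a𝔄 ≤ a_C` (so that (47) applies to the
full small field; the inequality between the record's constants is DISPLAYED). [cite: Balaban1985Variational, (116)–(117) p.295, (47) p.285, (57) p.286] -/
theorem norm_solPrOfRecordC_add_frakApr_lt {εC B₀ C₄ a₃ j a𝔄 ε₄ aC : ℝ}
    (R : Regime (frakGprOfRecordAtBg128 F N K k Ω U₀ 𝔥 Gp Δ2 a hposπ hQ) (0 : Space115Lit F N K k Ω U₀ →L[ℂ] Space115Lit F N K k Ω U₀)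
      (WprOfRecordAt F N K k Ω U₀ 𝔥 levB a hposb hQ εC Gp) B₀ 0 C₄ a₃ j a𝔄 ε₄)
    (hJ : ‖JOfRecordAtBg F N K k Ω U₀‖ ≤ j) {Z : PBond (F.P K) k → Matrix (Fin N) (Fin N) ℂ}
    (h𝔄Z : ‖frakAprOfRecordAtBg128C F N K k Ω U₀ 𝔥 levB Gp Δ2 a hposπ hQ Z‖ < a𝔄) (haC : ε₄ + a𝔄 ≤ aC) :
    ‖solPrOfRecordC F N K k Ω U₀ 𝔥 levB Gp Δ2 a hposπ hposb hQ εC ε₄ Z + frakAprOfRecordAtBg128C F N K k Ω U₀ 𝔥 levB Gp Δ2 a hposπ hQ Z‖ < aC :=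
  (norm_add_le _ _).trans_lt (lt_of_lt_of_le
    (add_lt_add_of_le_of_lt (norm_solPrOfRecordC_le F N K k Ω U₀ 𝔥 levB Gp Δ2 a hposπ hposb hQ R hJ h𝔄Z) h𝔄Z) haC)

/-! ## §3. (47) applied: the transformed full small field `T^{pr}(𝒜^{pr} + 𝔄^{pr})` on complex data -/

/-- **TOKEN (Prop. 3's analyticity of (47) at the framed Sect. C pair)** — «the transformation (47) … is defined and analytic» on the ball `‖A′‖ < a_C`:
`AnalyticOnNhd ℂ (T47 H₁^{pr} C^{sl,pr} ε_C) (ball 0 a_C)`, i.e. of the framed scheme's (47)-slot `linPrOfRecord … V` (constant in `V`).  The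
PRIMITIVE analyticity letter of this file (№632 (2) (Q-B)); DISPLAYED, never asserted; its supplier of record from the framed Sect. C regime is
`linPrAnalyticTok_of_regimeC` (lit ✓`analyticOnNhd_T47`). [cite: Balaban1985Variational, Prop. 3 p.289, (47) p.285, (52)–(54) p.286] -/
def LinPrAnalyticTok (εC aC : ℝ) : Prop :=
  AnalyticOnNhd ℂ (T47 (H1prOfRecordAtBg F N K k Ω U₀ 𝔥 levB a hposb hQ) (CslprOfRecord F N K k Ω U₀ 𝔥 levB) εC)
    (Metric.ball (0 : Space115Lit F N K k Ω U₀) aC)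

/-- Unfolding: the token is the analyticity of the (47)-slot of record `linPrOfRecord … V` on the ball (any `V`; `Iff.rfl`).
[cite: Balaban1985Variational, Prop. 3 p.289, (47) p.285 (bookkeeping)] -/
theorem linPrAnalyticTok_iff (εC aC : ℝ) (V : GaugeField (F.P K) k (SU N)) :
    LinPrAnalyticTok F N K k Ω U₀ 𝔥 levB a hposb hQ εC aC ↔
      AnalyticOnNhd ℂ (linPrOfRecord F N K k Ω U₀ 𝔥 levB a hposb hQ εC V) (Metric.ball (0 : Space115Lit F N K k Ω U₀) aC) := Iff.rfl

/-- ★ **THE SUPPLIER OF RECORD OF THE TOKEN**: under the framed Sect. C regime `Regime H₁^{pr} 0 C^{sl,pr} b 0 C₂ c₄ 0 a_C ε_C` and (ℓa-C)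
`Prop4Hyp C^{sl,pr} C₂ c₄` (both DISPLAYED), (47) is analytic on the ball — lit ✓`analyticOnNhd_T47` (Prop. 3; holomorphic ⇒ analytic on the
finite-dimensional carrier). [cite: Balaban1985Variational, Prop. 3 p.289, (44) p.285, (52)–(54) p.286] -/
theorem linPrAnalyticTok_of_regimeC {εC b C₂ c₄ aC : ℝ}
    (RC : Regime (H1prOfRecordAtBg F N K k Ω U₀ 𝔥 levB a hposb hQ) (0 : Space115Lit F N K k Ω U₀ →L[ℂ] Space115Lit F N K k Ω U₀)
      (CslprOfRecord F N K k Ω U₀ 𝔥 levB) b 0 C₂ c₄ 0 aC εC)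
    (hC : Prop4Hyp (CslprOfRecord F N K k Ω U₀ 𝔥 levB) C₂ c₄) :
    LinPrAnalyticTok F N K k Ω U₀ 𝔥 levB a hposb hQ εC aC :=
  analyticOnNhd_T47 RC hC

/-- ★★ **THE TRANSFORMED FULL SMALL FIELD ON COMPLEX DATA**: `A^{ᶜ}(Z) = T^{pr}(𝒜^{pr,ᶜ}(Z) + 𝔄^{pr,ᶜ}(Z))` — (47) `A = A′ − H₁^{pr}D(A′)` applied to the
full small field `A′ = 𝒜 + 𝔄` of the framed scheme, as a function of the complex datum (the exponent of §4 before the presentation `η·ev`).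
[cite: Balaban1985Variational, (47) p.285, (15) p.280, Prop. 6 (116) p.295, Prop. 9 p.309] -/
def linPrSmallFieldC (εC ε₄ : ℝ) (Z : PBond (F.P K) k → Matrix (Fin N) (Fin N) ℂ) : Space115Lit F N K k Ω U₀ :=
  T47 (H1prOfRecordAtBg F N K k Ω U₀ 𝔥 levB a hposb hQ) (CslprOfRecord F N K k Ω U₀ 𝔥 levB) εC
    (solPrOfRecordC F N K k Ω U₀ 𝔥 levB Gp Δ2 a hposπ hposb hQ εC ε₄ Z + frakAprOfRecordAtBg128C F N K k Ω U₀ 𝔥 levB Gp Δ2 a hposπ hQ Z)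

/-- Unfolding. [cite: Balaban1985Variational, (47) p.285 (bookkeeping)] -/
theorem linPrSmallFieldC_apply (εC ε₄ : ℝ) (Z : PBond (F.P K) k → Matrix (Fin N) (Fin N) ℂ) :
    linPrSmallFieldC F N K k Ω U₀ 𝔥 levB Gp Δ2 a hposπ hposb hQ εC ε₄ Z =
      T47 (H1prOfRecordAtBg F N K k Ω U₀ 𝔥 levB a hposb hQ) (CslprOfRecord F N K k Ω U₀ 𝔥 levB) εC
        (solPrOfRecordC F N K k Ω U₀ 𝔥 levB Gp Δ2 a hposπ hposb hQ εC ε₄ Z + frakAprOfRecordAtBg128C F N K k Ω U₀ 𝔥 levB Gp Δ2 a hposπ hQ Z) := rfl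

/-- ★ **REALITY**: on an `SU(N)`-valued datum the transformed full small field IS the framed scheme's (47)-slot applied to its full small field,
`linPrOfRecord … V (𝔖.sol V + 𝔖.𝔄 V)` — the argument of `𝔖.ev` in `𝔖.expoLinAt (linPrOfRecord …) V (𝔖.sol V)` (`rfl`).
[cite: Balaban1985Variational, (47) p.285, Prop. 6 (116) p.295, Prop. 9 p.309] -/
theorem linPrSmallFieldC_coeField (dom : Set (GaugeField (F.P K) k (SU N))) (εC B₀ C₄ a₃ j a𝔄 ε₄ : ℝ) (V : GaugeField (F.P K) k (SU N)) :
    linPrSmallFieldC F N K k Ω U₀ 𝔥 levB Gp Δ2 a hposπ hposb hQ εC ε₄ (coeField V) =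
      linPrOfRecord F N K k Ω U₀ 𝔥 levB a hposb hQ εC V
        ((bgSchemePrOfRecord F N K k Ω U₀ 𝔥 dom levB Gp Δ2 a hposπ hposb hQ εC B₀ C₄ a₃ j a𝔄 ε₄).sol V +
          (bgSchemePrOfRecord F N K k Ω U₀ 𝔥 dom levB Gp Δ2 a hposπ hposb hQ εC B₀ C₄ a₃ j a𝔄 ε₄).𝔄 V) := rfl

/-- ★★★ **THE TRANSFORMED FULL SMALL FIELD IS ℂ-ANALYTIC ON `𝒪`** (PRIMITIVE FORM): §2's analytic fixed point plus §1's analytic shift, composed with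
the DISPLAYED analyticity of (47) on the ball `‖A′‖ < a_C` (token `LinPrAnalyticTok`), which the full small field reaches because `‖𝒜^{pr,ᶜ}‖ ≤ ε₄`,
`‖𝔄^{pr,ᶜ}‖ < a𝔄` and `ε₄ + a𝔄 ≤ a_C` — Prop. 9 with Prop. 3 at the framed record, datum variable.
[cite: Balaban1985Variational, Prop. 9 p.309, Prop. 3 p.289, (47) p.285, Prop. 6 (116)–(121) p.295] -/
theorem analyticOnNhd_linPrSmallFieldC {εC B₀ C₄ a₃ j a𝔄 ε₄ aC : ℝ} {𝒪 : Set (PBond (F.P K) k → Matrix (Fin N) (Fin N) ℂ)} (h𝒪 : IsOpen 𝒪)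
    (R : Regime (frakGprOfRecordAtBg128 F N K k Ω U₀ 𝔥 Gp Δ2 a hposπ hQ) (0 : Space115Lit F N K k Ω U₀ →L[ℂ] Space115Lit F N K k Ω U₀)
      (WprOfRecordAt F N K k Ω U₀ 𝔥 levB a hposb hQ εC Gp) B₀ 0 C₄ a₃ j a𝔄 ε₄)
    (hJ : ‖JOfRecordAtBg F N K k Ω U₀‖ ≤ j) (h𝔄 : ∀ Z ∈ 𝒪, ‖frakAprOfRecordAtBg128C F N K k Ω U₀ 𝔥 levB Gp Δ2 a hposπ hQ Z‖ < a𝔄)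
    (hlog : ∀ Z ∈ 𝒪, ∀ c : PBond (F.P K) k, ‖Z c * star (Averaging.iter (avOfRecord F N K) k U₀ c : Matrix (Fin N) (Fin N) ℂ) - 1‖ < 1)
    (hW : WAnalyticPrTok F N K k Ω U₀ 𝔥 levB Gp a hposb hQ εC a₃) (hTan : LinPrAnalyticTok F N K k Ω U₀ 𝔥 levB a hposb hQ εC aC)
    (haC : ε₄ + a𝔄 ≤ aC) :
    AnalyticOnNhd ℂ (linPrSmallFieldC F N K k Ω U₀ 𝔥 levB Gp Δ2 a hposπ hposb hQ εC ε₄) 𝒪 := fun Z hZ => by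
  have hsum : AnalyticAt ℂ (fun Y => solPrOfRecordC F N K k Ω U₀ 𝔥 levB Gp Δ2 a hposπ hposb hQ εC ε₄ Y
      + frakAprOfRecordAtBg128C F N K k Ω U₀ 𝔥 levB Gp Δ2 a hposπ hQ Y) Z :=
    (analyticOnNhd_solPrOfRecordC F N K k Ω U₀ 𝔥 levB Gp Δ2 a hposπ hposb hQ h𝒪 R hJ h𝔄 hlog hW Z hZ).add
      (analyticAt_frakAprOfRecordAtBg128C F N K k Ω U₀ 𝔥 levB Gp Δ2 a hposπ hQ (hlog Z hZ))
  have hT : AnalyticAt ℂ (T47 (H1prOfRecordAtBg F N K k Ω U₀ 𝔥 levB a hposb hQ) (CslprOfRecord F N K k Ω U₀ 𝔥 levB) εC)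
      (solPrOfRecordC F N K k Ω U₀ 𝔥 levB Gp Δ2 a hposπ hposb hQ εC ε₄ Z + frakAprOfRecordAtBg128C F N K k Ω U₀ 𝔥 levB Gp Δ2 a hposπ hQ Z) :=
    hTan _ (mem_ball_zero_iff.2 (norm_solPrOfRecordC_add_frakApr_lt F N K k Ω U₀ 𝔥 levB Gp Δ2 a hposπ hposb hQ R hJ (h𝔄 Z hZ) haC))
  exact hT.comp_of_eq hsum rfl

/-- ★★ **THE SAME FROM THE FRAMED SECT. C REGIME** (the record's intended supplier of the token, DISPLAYED: `Regime H₁^{pr} 0 C^{sl,pr} b 0 C₂ c₄ 0 a_C ε_C`,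
`Prop4Hyp C^{sl,pr} C₂ c₄`; lit ✓`analyticOnNhd_T47`). [cite: Balaban1985Variational, Prop. 9 p.309, Prop. 3 p.289, (47) p.285, (52)–(54) p.286] -/
theorem analyticOnNhd_linPrSmallFieldC_of_regimeC {εC B₀ C₄ a₃ j a𝔄 ε₄ b C₂ c₄ aC : ℝ} {𝒪 : Set (PBond (F.P K) k → Matrix (Fin N) (Fin N) ℂ)}
    (h𝒪 : IsOpen 𝒪)
    (R : Regime (frakGprOfRecordAtBg128 F N K k Ω U₀ 𝔥 Gp Δ2 a hposπ hQ) (0 : Space115Lit F N K k Ω U₀ →L[ℂ] Space115Lit F N K k Ω U₀)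
      (WprOfRecordAt F N K k Ω U₀ 𝔥 levB a hposb hQ εC Gp) B₀ 0 C₄ a₃ j a𝔄 ε₄)
    (hJ : ‖JOfRecordAtBg F N K k Ω U₀‖ ≤ j) (h𝔄 : ∀ Z ∈ 𝒪, ‖frakAprOfRecordAtBg128C F N K k Ω U₀ 𝔥 levB Gp Δ2 a hposπ hQ Z‖ < a𝔄)
    (hlog : ∀ Z ∈ 𝒪, ∀ c : PBond (F.P K) k, ‖Z c * star (Averaging.iter (avOfRecord F N K) k U₀ c : Matrix (Fin N) (Fin N) ℂ) - 1‖ < 1)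
    (hW : WAnalyticPrTok F N K k Ω U₀ 𝔥 levB Gp a hposb hQ εC a₃)
    (RC : Regime (H1prOfRecordAtBg F N K k Ω U₀ 𝔥 levB a hposb hQ) (0 : Space115Lit F N K k Ω U₀ →L[ℂ] Space115Lit F N K k Ω U₀)
      (CslprOfRecord F N K k Ω U₀ 𝔥 levB) b 0 C₂ c₄ 0 aC εC)
    (hC : Prop4Hyp (CslprOfRecord F N K k Ω U₀ 𝔥 levB) C₂ c₄) (haC : ε₄ + a𝔄 ≤ aC) :
    AnalyticOnNhd ℂ (linPrSmallFieldC F N K k Ω U₀ 𝔥 levB Gp Δ2 a hposπ hposb hQ εC ε₄) 𝒪 :=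
  analyticOnNhd_linPrSmallFieldC F N K k Ω U₀ 𝔥 levB Gp Δ2 a hposπ hposb hQ h𝒪 R hJ h𝔄 hlog hW
    (linPrAnalyticTok_of_regimeC F N K k Ω U₀ 𝔥 levB a hposb hQ RC hC) haC

/-! ## §4. The complex background field `exp(iη·T^{pr}(𝒜^{pr} + 𝔄^{pr}))U₀` of the (47)-carrying framed scheme -/

/-- ★★ **THE COMPLEX BACKGROUND FIELD OF THE (47)-CARRYING FRAMED SCHEME OF RECORD**: `Ûᶜ(Z) = exp(iη·ev(T^{pr}(𝒜^{pr,ᶜ}(Z) + 𝔄^{pr,ᶜ}(Z))))·U₀` bondwise —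
«U = U′U₀, U′ = exp(iηA)», `A = T(A′)` (47), `A′ = 𝒜 + 𝔄`, with the fixed point and the shift on the COMPLEX datum; values in `Gᶜ`-matrices (no
retraction to `SU(N)`). [cite: Balaban1985Variational, (15) p.280, (19) p.281, (47) p.285, (112) p.294, Prop. 9 p.309; Balaban1988Hilbert, Prop. 1 p.13] -/
def bgFieldPrOfRecordC (εC ε₄ : ℝ) (Z : PBond (F.P K) k → Matrix (Fin N) (Fin N) ℂ) : PBond (F.P K) 0 → Matrix (Fin N) (Fin N) ℂ :=
  expOver U₀ (((((F.P K).eta k : ℂ)) • evLit F N K k Ω U₀) (linPrSmallFieldC F N K k Ω U₀ 𝔥 levB Gp Δ2 a hposπ hposb hQ εC ε₄ Z))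

/-- Unfolding on a bond: `Ûᶜ(Z)(b) = exp(i·(η·ev(A^{ᶜ}(Z)))(b)) · U₀(b)`. [cite: Balaban1985Variational, (15) p.280 (bookkeeping)] -/
theorem bgFieldPrOfRecordC_apply (εC ε₄ : ℝ) (Z : PBond (F.P K) k → Matrix (Fin N) (Fin N) ℂ) (b : PBond (F.P K) 0) :
    bgFieldPrOfRecordC F N K k Ω U₀ 𝔥 levB Gp Δ2 a hposπ hposb hQ εC ε₄ Z b =
      exp (Complex.I • ((((F.P K).eta k : ℂ)) • evLit F N K k Ω U₀) (linPrSmallFieldC F N K k Ω U₀ 𝔥 levB Gp Δ2 a hposπ hposb hQ εC ε₄ Z) b)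
        * (U₀ b : Matrix (Fin N) (Fin N) ℂ) := rfl

/-- ★ **REALITY (matrices)**: on an `SU(N)`-valued datum the complex background field IS the chart `expOver U₀` at the framed scheme's (47)-carrying
exponent `ev(T^{pr}_V(𝒜(V) + 𝔄(V)))` (`rfl`). [cite: Balaban1985Variational, (15) p.280, (47) p.285, Prop. 6 p.295, Prop. 9 p.309] -/
theorem bgFieldPrOfRecordC_coeField (dom : Set (GaugeField (F.P K) k (SU N))) (εC B₀ C₄ a₃ j a𝔄 ε₄ : ℝ) (V : GaugeField (F.P K) k (SU N)) :
    bgFieldPrOfRecordC F N K k Ω U₀ 𝔥 levB Gp Δ2 a hposπ hposb hQ εC ε₄ (coeField V) =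
      expOver U₀ ((bgSchemePrOfRecord F N K k Ω U₀ 𝔥 dom levB Gp Δ2 a hposπ hposb hQ εC B₀ C₄ a₃ j a𝔄 ε₄).ev
        (linPrOfRecord F N K k Ω U₀ 𝔥 levB a hposb hQ εC V
          ((bgSchemePrOfRecord F N K k Ω U₀ 𝔥 dom levB Gp Δ2 a hposπ hposb hQ εC B₀ C₄ a₃ j a𝔄 ε₄).sol V +
            (bgSchemePrOfRecord F N K k Ω U₀ 𝔥 dom levB Gp Δ2 a hposπ hposb hQ εC B₀ C₄ a₃ j a𝔄 ε₄).𝔄 V))) := rfl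

/-- ★★ **REALITY (`SU(N)`)**: on an `SU(N)`-valued datum and a bond where the (47)-carrying exponent at the fixed point is `SU(N)`-valued the complex
background field IS (the matrix of) the framed scheme's (47)-carrying chart image of the fixed point `𝔖.chartCfgLin T^{pr} V` ((A4)
✓`BgScheme.coe_chartLin_of_mem`). [cite: Balaban1985Variational, (15) p.280, (47) p.285, Prop. 6 p.295, Prop. 9 p.309] -/
theorem bgFieldPrOfRecordC_coeField_eq_coe_chartCfgLin (dom : Set (GaugeField (F.P K) k (SU N))) (εC B₀ C₄ a₃ j a𝔄 ε₄ : ℝ)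
    {V : GaugeField (F.P K) k (SU N)} {b : PBond (F.P K) 0}
    (h : (bgSchemePrOfRecord F N K k Ω U₀ 𝔥 dom levB Gp Δ2 a hposπ hposb hQ εC B₀ C₄ a₃ j a𝔄 ε₄).expoLinAt
      (linPrOfRecord F N K k Ω U₀ 𝔥 levB a hposb hQ εC) V
        ((bgSchemePrOfRecord F N K k Ω U₀ 𝔥 dom levB Gp Δ2 a hposπ hposb hQ εC B₀ C₄ a₃ j a𝔄 ε₄).sol V) b ∈ Matrix.specialUnitaryGroup (Fin N) ℂ) :
    bgFieldPrOfRecordC F N K k Ω U₀ 𝔥 levB Gp Δ2 a hposπ hposb hQ εC ε₄ (coeField V) b =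
      (((bgSchemePrOfRecord F N K k Ω U₀ 𝔥 dom levB Gp Δ2 a hposπ hposb hQ εC B₀ C₄ a₃ j a𝔄 ε₄).chartCfgLin
        (linPrOfRecord F N K k Ω U₀ 𝔥 levB a hposb hQ εC) V b : SU N) : Matrix (Fin N) (Fin N) ℂ) := by
  rw [← BgScheme.chartLin_sol, BgScheme.coe_chartLin_of_mem _ _ h]
  rfl

/-- The same on every bond under the Lie token of the framed scheme at `V` ((A4) `LieLinTokAt`): `Ûᶜ(↑V) = ↑(𝔖.chartCfgLin T^{pr} V)`.
[cite: Balaban1985Variational, (15) p.280, (47) p.285, Prop. 9 p.309] -/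
theorem bgFieldPrOfRecordC_coeField_eq_coeField_chartCfgLin (dom : Set (GaugeField (F.P K) k (SU N))) (εC B₀ C₄ a₃ j a𝔄 ε₄ : ℝ)
    {V : GaugeField (F.P K) k (SU N)}
    (h : (bgSchemePrOfRecord F N K k Ω U₀ 𝔥 dom levB Gp Δ2 a hposπ hposb hQ εC B₀ C₄ a₃ j a𝔄 ε₄).LieLinTokAt
      (linPrOfRecord F N K k Ω U₀ 𝔥 levB a hposb hQ εC) V) :
    bgFieldPrOfRecordC F N K k Ω U₀ 𝔥 levB Gp Δ2 a hposπ hposb hQ εC ε₄ (coeField V) =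
      coeField ((bgSchemePrOfRecord F N K k Ω U₀ 𝔥 dom levB Gp Δ2 a hposπ hposb hQ εC B₀ C₄ a₃ j a𝔄 ε₄).chartCfgLin
        (linPrOfRecord F N K k Ω U₀ 𝔥 levB a hposb hQ εC) V) :=
  funext fun b => bgFieldPrOfRecordC_coeField_eq_coe_chartCfgLin F N K k Ω U₀ 𝔥 levB Gp Δ2 a hposπ hposb hQ dom εC B₀ C₄ a₃ j a𝔄 ε₄
    (BgScheme.expoLinAt_sol_mem_of_lieLinTokAt _ _ h b)

/-- ★★★ **THE COMPLEX BACKGROUND FIELD OF THE (47)-CARRYING FRAMED SCHEME IS ℂ-ANALYTIC ON `𝒪`** (PRIMITIVE FORM: the entire chart `expOver U₀` after the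
linear presentation `η·ev` after §3) — Prop. 9's «extension to an analytic function of `Gᶜ`-valued configurations» at the framed record, modulo the
displayed regime ∕ analyticity letters. [cite: Balaban1985Variational, Prop. 9 p.309, Prop. 3 p.289, Sect. G p.307, (15) p.280, (47) p.285; Balaban1988Hilbert, Prop. 1 p.13] -/
theorem analyticOnNhd_bgFieldPrOfRecordC {εC B₀ C₄ a₃ j a𝔄 ε₄ aC : ℝ} {𝒪 : Set (PBond (F.P K) k → Matrix (Fin N) (Fin N) ℂ)} (h𝒪 : IsOpen 𝒪)
    (R : Regime (frakGprOfRecordAtBg128 F N K k Ω U₀ 𝔥 Gp Δ2 a hposπ hQ) (0 : Space115Lit F N K k Ω U₀ →L[ℂ] Space115Lit F N K k Ω U₀)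
      (WprOfRecordAt F N K k Ω U₀ 𝔥 levB a hposb hQ εC Gp) B₀ 0 C₄ a₃ j a𝔄 ε₄)
    (hJ : ‖JOfRecordAtBg F N K k Ω U₀‖ ≤ j) (h𝔄 : ∀ Z ∈ 𝒪, ‖frakAprOfRecordAtBg128C F N K k Ω U₀ 𝔥 levB Gp Δ2 a hposπ hQ Z‖ < a𝔄)
    (hlog : ∀ Z ∈ 𝒪, ∀ c : PBond (F.P K) k, ‖Z c * star (Averaging.iter (avOfRecord F N K) k U₀ c : Matrix (Fin N) (Fin N) ℂ) - 1‖ < 1)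
    (hW : WAnalyticPrTok F N K k Ω U₀ 𝔥 levB Gp a hposb hQ εC a₃) (hTan : LinPrAnalyticTok F N K k Ω U₀ 𝔥 levB a hposb hQ εC aC)
    (haC : ε₄ + a𝔄 ≤ aC) :
    AnalyticOnNhd ℂ (bgFieldPrOfRecordC F N K k Ω U₀ 𝔥 levB Gp Δ2 a hposπ hposb hQ εC ε₄) 𝒪 := fun Z hZ => by
  have hev : AnalyticAt ℂ (fun Y => ((((F.P K).eta k : ℂ)) • evLit F N K k Ω U₀)
      (linPrSmallFieldC F N K k Ω U₀ 𝔥 levB Gp Δ2 a hposπ hposb hQ εC ε₄ Y)) Z :=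
    ((LinearMap.toContinuousLinearMap ((((F.P K).eta k : ℂ)) • evLit F N K k Ω U₀)).analyticAt _).comp
      (analyticOnNhd_linPrSmallFieldC F N K k Ω U₀ 𝔥 levB Gp Δ2 a hposπ hposb hQ h𝒪 R hJ h𝔄 hlog hW hTan haC Z hZ)
  exact (analyticAt_expOver U₀ _).comp hev

/-- ★★ **THE SAME FROM THE FRAMED SECT. C REGIME** (`RC`, `Prop4Hyp C^{sl,pr} C₂ c₄`, `ε₄ + a𝔄 ≤ a_C` DISPLAYED; lit ✓`analyticOnNhd_T47`).
[cite: Balaban1985Variational, Prop. 9 p.309, Prop. 3 p.289, (47) p.285, (52)–(54) p.286] -/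
theorem analyticOnNhd_bgFieldPrOfRecordC_of_regimeC {εC B₀ C₄ a₃ j a𝔄 ε₄ b C₂ c₄ aC : ℝ} {𝒪 : Set (PBond (F.P K) k → Matrix (Fin N) (Fin N) ℂ)}
    (h𝒪 : IsOpen 𝒪)
    (R : Regime (frakGprOfRecordAtBg128 F N K k Ω U₀ 𝔥 Gp Δ2 a hposπ hQ) (0 : Space115Lit F N K k Ω U₀ →L[ℂ] Space115Lit F N K k Ω U₀)
      (WprOfRecordAt F N K k Ω U₀ 𝔥 levB a hposb hQ εC Gp) B₀ 0 C₄ a₃ j a𝔄 ε₄)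
    (hJ : ‖JOfRecordAtBg F N K k Ω U₀‖ ≤ j) (h𝔄 : ∀ Z ∈ 𝒪, ‖frakAprOfRecordAtBg128C F N K k Ω U₀ 𝔥 levB Gp Δ2 a hposπ hQ Z‖ < a𝔄)
    (hlog : ∀ Z ∈ 𝒪, ∀ c : PBond (F.P K) k, ‖Z c * star (Averaging.iter (avOfRecord F N K) k U₀ c : Matrix (Fin N) (Fin N) ℂ) - 1‖ < 1)
    (hW : WAnalyticPrTok F N K k Ω U₀ 𝔥 levB Gp a hposb hQ εC a₃)
    (RC : Regime (H1prOfRecordAtBg F N K k Ω U₀ 𝔥 levB a hposb hQ) (0 : Space115Lit F N K k Ω U₀ →L[ℂ] Space115Lit F N K k Ω U₀)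
      (CslprOfRecord F N K k Ω U₀ 𝔥 levB) b 0 C₂ c₄ 0 aC εC)
    (hC : Prop4Hyp (CslprOfRecord F N K k Ω U₀ 𝔥 levB) C₂ c₄) (haC : ε₄ + a𝔄 ≤ aC) :
    AnalyticOnNhd ℂ (bgFieldPrOfRecordC F N K k Ω U₀ 𝔥 levB Gp Δ2 a hposπ hposb hQ εC ε₄) 𝒪 :=
  analyticOnNhd_bgFieldPrOfRecordC F N K k Ω U₀ 𝔥 levB Gp Δ2 a hposπ hposb hQ h𝒪 R hJ h𝔄 hlog hW
    (linPrAnalyticTok_of_regimeC F N K k Ω U₀ 𝔥 levB a hposb hQ RC hC) haC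

end Record

end Literature.MathematicalPhysics.QuantumFieldTheory.Balaban1983to89.Node00
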